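import Literature.Analysis.Complex.CircleHomomorphisms
import Mathlib.Analysis.SpecialFunctions.Complex.Circle
import HarnessLib

/-!
# Continuous characters of the circle group are integral powers

Topic `Literature/Analysis/Complex`, continuation of `CircleHomomorphisms` (continuous unitary one-parameter
groups `ℝ → S¹` are `t ↦ e^{ikt}`).  Here: a CONTINUOUS group homomorphism `χ : Circle →* Circle` is `z ↦ z^m`
for a (unique) integer `m` (`CircleChar.exists_eq_zpow`, `CircleChar.zpow_eq_zpow_iff`) — pull back along
`Circle.exp`, apply `exists_eq_exp_of_continuous_unitary_hom`, and read integrality off `Circle.exp (2π) = 1`.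
Folklore (e.g. Hewitt–Ross, *Abstract Harmonic Analysis I*, (23.27)(a): the character group of `𝕋` is `ℤ`).

Provenance: Hodge-CM model-construction cell (unit `pub-hodgecm-mc-binder-1-g2`): integrality of the
archimedean vacuum-character offsets (the `m` in "two splittings differ by `ν ∘ det`, `ν_∞(z) = z^m`").
-/

noncomputable section

open Complex

namespace Literature.Analysis.Complex

namespace CircleChar

/-- **Continuous characters of `S¹` are `z ↦ z^m`**, `m ∈ ℤ`. [folklore] -/
theorem exists_eq_zpow (χ : Circle →* Circle) (hχ : Continuous χ) : ∃ m : ℤ, ∀ z : Circle, χ z = z ^ m := by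
  set f : ℝ → ℂ := fun t => ((χ (Circle.exp t) : Circle) : ℂ) with hf
  have hfc : Continuous f := continuous_subtype_val.comp (hχ.comp Circle.exp.continuous)
  have h1 : ∀ t, ‖f t‖ = 1 := fun t => Circle.norm_coe _
  have hmul : ∀ s t, f (s + t) = f s * f t := by
    intro s t
    simp only [hf, Circle.exp_add, map_mul, Circle.coe_mul]
  obtain ⟨k, hk⟩ := exists_eq_exp_of_continuous_unitary_hom hfc h1 hmul
  -- periodicity `Circle.exp (2π) = 1` forces `k ∈ ℤ`
  have hper : Complex.exp (k * (2 * Real.pi) * I) = 1 := by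
    have h := hk (2 * Real.pi)
    simp only [hf, Circle.exp_two_pi, map_one, Circle.coe_one] at h
    rw [h]
    push_cast
    ring_nf
  obtain ⟨n, hn⟩ := Complex.exp_eq_one_iff.mp hper
  have h2 : (2 * (Real.pi : ℂ) * I) ≠ 0 := by
    simp [Real.pi_ne_zero, I_ne_zero]
  have hkn : (k : ℂ) = n := by
    apply mul_right_cancel₀ h2
    rw [← hn]
    ring
  refine ⟨n, fun z => ?_⟩
  obtain ⟨t, rfl⟩ := Circle.exp_surjective z
  apply Circle.ext
  rw [Circle.coe_zpow, Circle.coe_exp, ← Complex.exp_int_mul, show ((χ (Circle.exp t) : Circle) : ℂ) = f t from rfl,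
    hk t, hkn]
  congr 1
  ring

/-- Integral powers are distinguished by the circle: `z^m = z^n` for all `z ∈ S¹` iff `m = n`. [folklore] -/
theorem zpow_eq_zpow_iff (m n : ℤ) : (∀ z : Circle, z ^ m = z ^ n) ↔ m = n := by
  refine ⟨fun h => ?_, fun h z => by rw [h]⟩
  by_contra hne
  -- evaluate at `exp (2π/(m-n))`-type point: use `exp t` with `(m - n) t ∉ 2πℤ`
  have hd : (m : ℝ) - n ≠ 0 := by
    have : (m : ℝ) ≠ n := by exact_mod_cast hne
    exact sub_ne_zero.mpr this
  set t : ℝ := Real.pi / (m - n) with ht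
  have h1 := congrArg (fun w : Circle => (w : ℂ)) (h (Circle.exp t))
  simp only [Circle.coe_zpow, Circle.coe_exp, ← Complex.exp_int_mul] at h1
  -- exp (m t I) = exp (n t I) ⇒ (m - n) t ∈ 2π ℤ, but (m - n) t = π
  rw [Complex.exp_eq_exp_iff_exists_int] at h1
  obtain ⟨j, hj⟩ := h1
  have hπ : ((m : ℂ) - n) * t * I = j * (2 * Real.pi * I) := by
    have := hj
    linear_combination this
  have hreal : ((m : ℝ) - n) * t = j * (2 * Real.pi) := by
    have h' := congrArg Complex.re (show ((m : ℂ) - n) * t * I * (-I) = j * (2 * Real.pi * I) * (-I) by rw [hπ])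
    simp at h'
    linarith [h']
  rw [ht, mul_div_cancel₀ _ hd] at hreal
  -- π = j * 2π ⇒ 1 = 2 j, impossible
  have : (1 : ℝ) = 2 * j := by
    have hπ0 : Real.pi ≠ 0 := Real.pi_ne_zero
    field_simp at hreal
    linarith [hreal]
  have h2j : (2 : ℤ) * j = 1 := by exact_mod_cast this.symm
  omega

/-- The exponent of a continuous character is unique. [folklore] -/
theorem existsUnique_eq_zpow (χ : Circle →* Circle) (hχ : Continuous χ) : ∃! m : ℤ, ∀ z : Circle, χ z = z ^ m := by
  obtain ⟨m, hm⟩ := exists_eq_zpow χ hχ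
  refine ⟨m, hm, fun n hn => ((zpow_eq_zpow_iff n m).mp fun z => ?_)⟩
  rw [← hn z, hm z]

/-! ## Continuous characters into `ℂˣ` are unitary, hence integral powers

Appended (unit `pub-hodgecm-mc-binder-1-g3`): the discrepancy characters of the see-saw renormalisation
(`NumberTheory/Automorphic/AdelicSchwartzBruhatTensorCharacter`, `continuous_charV`) are `ℂˣ`-valued and
continuous as `ℂ`-valued functions; on a compact torus they are therefore unitary and the classification
above applies. -/

/-- A continuous character `χ : S¹ →* ℂˣ` (continuity of `z ↦ (χ z : ℂ)`) is UNITARY: `‖χ z‖ = 1` — the image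
of the compact group is a bounded subgroup of `ℂˣ`, and if `‖χ w‖ > 1` the powers `χ(wⁿ)` would be unbounded
(applied to `w = z` and `w = z⁻¹`). [folklore] -/
theorem norm_map_eq_one (χ : Circle →* ℂˣ) (hχ : Continuous fun z : Circle => (χ z : ℂ)) (z : Circle) :
    ‖(χ z : ℂ)‖ = 1 := by
  obtain ⟨R, hR⟩ := isBounded_iff_forall_norm_le.mp (isCompact_range hχ).isBounded
  have hbd : ∀ w : Circle, ‖(χ w : ℂ)‖ ≤ R := fun w => hR _ ⟨w, rfl⟩
  have hle : ∀ w : Circle, ‖(χ w : ℂ)‖ ≤ 1 := by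
    intro w
    by_contra hw
    rw [not_le] at hw
    obtain ⟨n, hn⟩ := pow_unbounded_of_one_lt R hw
    have hwn := hbd (w ^ n)
    rw [map_pow, Units.val_pow_eq_pow_val, norm_pow] at hwn
    exact absurd (lt_of_lt_of_le hn hwn) (lt_irrefl _)
  have hz' := hle z⁻¹
  rw [map_inv, Units.val_inv_eq_inv_val, norm_inv,
    inv_le_one₀ (norm_pos_iff.mpr (χ z).ne_zero)] at hz'
  exact le_antisymm (hle z) hz'

/-- **Continuous characters `S¹ →* ℂˣ` are `z ↦ z^m`**, `m ∈ ℤ` (unitary by `norm_map_eq_one`, then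
`exists_eq_zpow`). [folklore] -/
theorem exists_eq_zpow_of_units (χ : Circle →* ℂˣ) (hχ : Continuous fun z : Circle => (χ z : ℂ)) :
    ∃ m : ℤ, ∀ z : Circle, (χ z : ℂ) = (z : ℂ) ^ m := by
  let χ' : Circle →* Circle :=
    { toFun := fun z => ⟨(χ z : ℂ), mem_sphere_zero_iff_norm.2 (norm_map_eq_one χ hχ z)⟩
      map_one' := Circle.ext (by
        show ((χ 1 : ℂˣ) : ℂ) = ((1 : Circle) : ℂ)
        rw [map_one, Units.val_one, Circle.coe_one])
      map_mul' := fun z w => Circle.ext (by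
        show ((χ (z * w) : ℂˣ) : ℂ) = (χ z : ℂ) * (χ w : ℂ)
        rw [map_mul, Units.val_mul]) }
  have hχ' : Continuous χ' := Continuous.subtype_mk hχ _
  obtain ⟨m, hm⟩ := exists_eq_zpow χ' hχ'
  refine ⟨m, fun z => ?_⟩
  show ((χ' z : Circle) : ℂ) = (z : ℂ) ^ m
  rw [hm z, Circle.coe_zpow]

/-- Uniqueness of the exponent for `ℂˣ`-valued continuous characters. [folklore] -/
theorem existsUnique_eq_zpow_of_units (χ : Circle →* ℂˣ) (hχ : Continuous fun z : Circle => (χ z : ℂ)) :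
    ∃! m : ℤ, ∀ z : Circle, (χ z : ℂ) = (z : ℂ) ^ m := by
  obtain ⟨m, hm⟩ := exists_eq_zpow_of_units χ hχ
  refine ⟨m, hm, fun n hn => (zpow_eq_zpow_iff n m).mp fun z => Circle.ext ?_⟩
  rw [Circle.coe_zpow, Circle.coe_zpow, ← hn z, hm z]

end CircleChar

end Literature.Analysis.Complex

end
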